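import Mathlib
import Summits.Ventures.PercRepro.TriangleCapBlockWitness

/-!
# PercRepro — THE REGULAR CELL `t = ℓ D` AS A SET, FOR EVERY `ℓ ≤ D` (p3, gen 54; part 289)

THEOREM (`regular_cell_iff`, `1 ≤ ℓ ≤ D`, `t = ℓ D`, `2 t ≤ s`): `j` is the band value of a triangle-free graph on
`ℓ + 1 + (s − t)` vertices with `s` edges, a vertex `w` of degree `s − t` and every off-degree `≤ D` IFF
`2 j + 2 t (D − 1) = t (t − 1) + ℓ D (D − ℓ) + Σ_{m < N} k_m (ℓ − k_m)` for some row sizes `1 ≤ k_m ≤ ℓ` with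
`Σ_{m < N} k_m = ℓ D` — THE REGULAR CELL IS THE SET OF ROW-EXCESS NUMBERS.  (⇒) is the regular cell identity of
part 287 with the nonempty rows enumerated (`Finset.equivFin`); (⇐) is the cyclic block witness of part 288 with
the row-excess identity `Σ k (ℓ − k) + Σ k (k − 1) = (ℓ − 1) Σ k` (`row_excess_identity`).  Axioms: standard.
-/

namespace PercRepro

namespace TriangleCap

namespace C047

open Finset

/-- The excess identity of the row sizes: `ℓ D (D − 1) + Σ k (k − 1) + ℓ D (D − ℓ) + Σ k (ℓ − k) = 2 ℓ D (D − 1) + ℓ D`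
when `k m ≤ ℓ` and `Σ k = ℓ D` — i.e. `Σ k (ℓ − k) + Σ k (k − 1) = (ℓ − 1) Σ k`. -/
theorem row_excess_identity (ℓ : ℕ) (k : ℕ → ℕ) (N : ℕ) (hkℓ : ∀ m, m < N → k m ≤ ℓ) :
    ∑ m ∈ range N, k m * (ℓ - k m) + ∑ m ∈ range N, k m * (k m - 1) = (ℓ - 1) * ∑ m ∈ range N, k m := by
  rw [mul_sum, ← sum_add_distrib]
  apply sum_congr rfl
  intro m hm
  have hk := hkℓ m (mem_range.mp hm)
  have := deficiency_term (k m) ℓ hk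
  rcases Nat.eq_zero_or_pos ℓ with rfl | hℓ
  · have : k m = 0 := by omega
    simp [this]
  · obtain ⟨ℓ', rfl⟩ : ∃ ℓ', ℓ = ℓ' + 1 := ⟨ℓ - 1, by omega⟩
    rw [Nat.add_sub_cancel]
    nlinarith

/-- **THE REGULAR CELL AS A SET:** for `1 ≤ ℓ ≤ D`, `t = ℓ D`, `2 t ≤ s`, `j` is the band value of a triangle-free
graph on `ℓ + 1 + (s − t)` vertices with `s` edges, a vertex `w` of degree `s − t` and every off-degree `≤ D` IFF
`2 j + 2 t (D − 1) = t (t − 1) + ℓ D (D − ℓ) + Σ_{m < N} k m (ℓ − k m)` for some row sizes `1 ≤ k m ≤ ℓ`, `m < N`,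
with `Σ_{m < N} k m = ℓ D`. -/
theorem regular_cell_iff (s t ℓ D j : ℕ) (hℓ : 1 ≤ ℓ) (hℓD : ℓ ≤ D) (ht : t = ℓ * D) (hs : 2 * t ≤ s) :
    (∃ (H : SimpleGraph (Fin (ℓ + 1 + (s - t)))) (_ : DecidableRel H.Adj), H.CliqueFree 3 ∧
      H.edgeFinset.card = s ∧ ∃ w, deg H w + t = s ∧ (∀ v, offDeg H w v ≤ D) ∧
        ∑ v, deg H v * deg H v + 2 * (t * (s - t - 1)) + 2 * j = s * (s + 1)) ↔
    ∃ (N : ℕ) (k : ℕ → ℕ), (∀ m, m < N → 1 ≤ k m ∧ k m ≤ ℓ) ∧ ∑ m ∈ range N, k m = ℓ * D ∧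
      2 * j + 2 * (t * (D - 1)) = t * (t - 1) + ℓ * D * (D - ℓ) + ∑ m ∈ range N, k m * (ℓ - k m) := by
  constructor
  · rintro ⟨H, _, hfree, hsH, w, hw, hD, hj⟩
    have hℓ' : (nonNbrs H w).card = ℓ := by
      have := card_nonNbrs_add H w
      rw [Fintype.card_fin] at this
      omega
    have hw1 : 1 ≤ deg H w := by
      have : 0 < ℓ * D := Nat.mul_pos (by omega) (by omega)
      omega
    have hid := regular_cell_identity H hfree s t j ℓ D hsH w hw hw1 hj hD hℓ' hℓD ht
    have htE : (offEdges H w).card = t := by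
      have := card_offEdges_add_deg H w
      omega
    obtain ⟨hI, -⟩ := regular_cell_forced H hfree w ℓ D hℓ' (by rw [htE, ht]) hD
    have hatt := attach_add_card_inside H hfree w
    rw [htE, hI, add_zero] at hatt
    -- enumerate the nonempty rows
    set R := (univ.filter (fun y => H.Adj w y)).filter (fun y => 1 ≤ offDeg H w y) with hR
    set N := R.card with hN
    let e := R.equivFin
    let k : ℕ → ℕ := fun m => if h : m < N then offDeg H w (e.symm ⟨m, h⟩) else 0
    have hsumk : ∀ f : Fin (ℓ + 1 + (s - t)) → ℕ,
        ∑ m ∈ range N, (if h : m < N then f (e.symm ⟨m, h⟩) else 0) = ∑ y ∈ R, f y := by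
      intro f
      rw [← Fin.sum_univ_eq_sum_range (fun m => if h : m < N then f (e.symm ⟨m, h⟩) else 0) N]
      rw [← sum_coe_sort R f, ← Equiv.sum_comp e.symm (fun y : R => f y)]
      apply sum_congr rfl
      intro i _
      rw [dif_pos i.isLt]
    refine ⟨N, k, fun m hm => ?_, ?_, ?_⟩
    · simp only [k, dif_pos hm]
      have hmem := (e.symm ⟨m, hm⟩).2
      have h1 := mem_filter.mp hmem
      have h2 := mem_filter.mp h1.1
      refine ⟨h1.2, ?_⟩
      have := offDeg_le_card_nonNbrs_of_adj H hfree w _ h2.2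
      rw [hℓ'] at this
      exact this
    · show ∑ m ∈ range N, (if h : m < N then offDeg H w (e.symm ⟨m, h⟩) else 0) = ℓ * D
      rw [hsumk (fun y => offDeg H w y)]
      -- the rows of size `0` contribute nothing: `Σ_R = attach = t`
      have : ∑ y ∈ R, offDeg H w y = ∑ y ∈ univ.filter (fun y => H.Adj w y), offDeg H w y := by
        rw [hR, sum_filter]
        apply sum_congr rfl
        intro y _
        split_ifs with h
        · rfl
        · omega
      rw [this]
      unfold attach at hatt
      omega
    · show 2 * j + 2 * (t * (D - 1)) = t * (t - 1) + ℓ * D * (D - ℓ) +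
        ∑ m ∈ range N, (if h : m < N then offDeg H w (e.symm ⟨m, h⟩) else 0) *
          (ℓ - (if h : m < N then offDeg H w (e.symm ⟨m, h⟩) else 0))
      have hsum2 : ∑ m ∈ range N, (if h : m < N then offDeg H w (e.symm ⟨m, h⟩) else 0) *
          (ℓ - (if h : m < N then offDeg H w (e.symm ⟨m, h⟩) else 0)) =
          ∑ m ∈ range N, (if h : m < N then offDeg H w (e.symm ⟨m, h⟩) * (ℓ - offDeg H w (e.symm ⟨m, h⟩)) else 0) := by
        apply sum_congr rfl
        intro m hm
        rw [dif_pos (mem_range.mp hm), dif_pos (mem_range.mp hm)]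
      rw [hsum2, hsumk (fun y => offDeg H w y * (ℓ - offDeg H w y))]
      have : ∑ y ∈ R, offDeg H w y * (ℓ - offDeg H w y) =
          ∑ y ∈ univ.filter (fun y => H.Adj w y), offDeg H w y * (ℓ - offDeg H w y) := by
        rw [hR, sum_filter]
        apply sum_congr rfl
        intro y _
        split_ifs with h
        · rfl
        · have : offDeg H w y = 0 := by omega
          rw [this, zero_mul]
      rw [this]
      exact hid
  · rintro ⟨N, k, hk, hsum, hj⟩
    subst ht
    obtain ⟨H, inst, hfree, hsH, w, hw, hD, -, hjH⟩ :=
      regularMultiWitness s ℓ D k N hℓ hℓD (fun m hm => (hk m hm).1) (fun m hm => (hk m hm).2) hsum hs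
    refine ⟨H, inst, hfree, hsH, w, hw, hD, ?_⟩
    have hex := row_excess_identity ℓ k N (fun m hm => (hk m hm).2)
    rw [hsum] at hex
    have e : ℓ * D * (ℓ * D - 1) - (ℓ * (D * (D - 1)) + ∑ m ∈ range N, k m * (k m - 1)) = 2 * j := by
      have h1 : (ℓ - 1) * (ℓ * D) + ℓ * D = ℓ * (ℓ * D) := by
        obtain ⟨ℓ', rfl⟩ : ∃ ℓ', ℓ = ℓ' + 1 := ⟨ℓ - 1, by omega⟩
        rw [Nat.add_sub_cancel]
        ring
      have h2 : ℓ * D * (D - ℓ) + (ℓ - 1) * (ℓ * D) + ℓ * D * (D - 1) = 2 * (ℓ * D * (D - 1)) := by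
        obtain ⟨ℓ', rfl⟩ : ∃ ℓ', ℓ = ℓ' + 1 := ⟨ℓ - 1, by omega⟩
        obtain ⟨m, hm⟩ : ∃ m, D = ℓ' + 1 + m := ⟨D - (ℓ' + 1), by omega⟩
        subst hm
        have e1 : ℓ' + 1 + m - (ℓ' + 1) = m := by omega
        have e2 : ℓ' + 1 - 1 = ℓ' := by omega
        have e3 : ℓ' + 1 + m - 1 = ℓ' + m := by omega
        rw [e1, e2, e3]
        ring
      have h3 : ℓ * (D * (D - 1)) = ℓ * D * (D - 1) := by ring
      omega
    rw [e] at hjH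
    exact hjH

end C047

end TriangleCap

end PercRepro
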